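import Summits.BirchSwinnertonDyer.BirchSwinnertonDyer.Theorems.GoldfeldAllTwistsTwoConverseTwinQuarterTraceSignaturesE
import Summits.BirchSwinnertonDyer.BirchSwinnertonDyer.Theorems.GoldfeldAllTwistsTwoConverseTwinQuarterTraceSignaturesEFModFour
import Summits.BirchSwinnertonDyer.BirchSwinnertonDyer.Theorems.GoldfeldAllTwistsTwoConverseTwinQuarterTracePartnerPackageEModFour
import Summits.BirchSwinnertonDyer.BirchSwinnertonDyer.Theorems.GoldfeldAllTwistsTwoConverseTwinQuarterTracePartnerEHeightModFour
import HarnessLib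

set_option linter.dupNamespace false -- namespace `…BirchSwinnertonDyer.BirchSwinnertonDyer…` is the cell's (D-0017 nested layout)
set_option autoImplicit false

/-!
# C7 / `p ≡ 1 (mod 4)` twin (file G2c) of `…TwinQuarterTraceSignaturesE`: `exists_chiE_dataK_modFour`, `exists_chiE_package_L_modFour`

Cell `bsd-goldfeld`, seat `bsd-goldfeld-s1p-c3x` (gen 12); planner RULING (cccxxxviii) (3) «TRANCHE C7-3 (formula axis)», F12 chain (the C7
`χ_Z` quarter-point argument needs the X5-shape `χ_e` package over `K[1]`, `p ≡ 1 (mod 4)`-generic). `--supports stmt-BirchSwinnertonDyer-19140` as a HELPER.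
Theses-free; theorems only; no definition, no `sorry`, no new fact; binders EXACTLY as the originals with `hp8 : p % 8 = 5` ↦ `hp4 : p % 4 = 1`. The proofs are the
originals verbatim with the cosmetic callees replaced by their landed `_modFour` twins. HONEST FRAMING: re-exports; no case of twin″ is decided;
BSD is not proved by any of this.
-/


noncomputable section

open scoped Classical IntermediateField

open WeierstrassCurve Literature.NumberTheory.EllipticCurves Literature.NumberTheory.EllipticCurves.ModularForms
  Literature.NumberTheory.EllipticCurves.CaiShuTian2014 Literature.NumberTheory.EllipticCurves.CoatesLiTianZhai2015
  Literature.Computability.Cryptography.Hallgren2005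

namespace Summit.BirchSwinnertonDyer.BirchSwinnertonDyer.Theorems.GoldfeldGoodTwists

-- the cell's point-group world over `K[1]` / `F[1]` / `ℂ` (A2a″'s); file-local
attribute [local instance 2000] Classical.propDecidable

section ChiE
variable {K : Type} [Field K] [NumberField K] (ι : K →+* ℂ) [FiniteDimensional K (ringClassField K ι 1)]
  [IsGalois K (ringClassField K ι 1)] [NumberField (ringClassField K ι 1)]

/-! ## §1 A2a″'s K-side: complex conjugation, the partner point `Y_e`, the half-trace relation -/

set_option maxHeartbeats 400000 in
/-- **A2a″'s K-side data.** For `K = ℚ(√−2qp)` (cells C4 ∪ C6: `q ≡ 3 (4)`, `p ≡ 5 (8)`, `(q/7) = −1`, `(−7/p) = 1`, `(−7)^{(p−1)/4} ≡ 1`)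
with `r_q² = −q`, `r_p² = p` in `K[1]`: complex conjugation `τ ∈ Gal(K[1]/ℚ)`, a Heegner datum `H₂` and point `P₂ ∈ X₀(49)(F)` of the partner
field `F = ℚ(r_qr_p) ⊂ K[1]`, and the HALF-TRACE RELATION `M₁ • P_e = (2m₁) • Y_e + t₁` (`M₁, m₁` odd, `t₁` torsion, `Y_e = (P₂)_{K[1]}`
fixed by `Stab(r_qr_p)`), `P_e = Σ_σ χ_e(σ) σy_K`. [cite: Gross1984, §§4–5] [cite: GrossLMS1991, Prop. 5.3] [cite: Cox2013, §6.A Thm. 6.1] -/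
theorem exists_chiE_dataK_modFour (h14 : thm14_rankOne_twist) (hCST : thm11_ringClassChar)
    (hGZ : ∀ (N : ℕ) [NeZero N] (W : WeierstrassCurve ℚ) (K : Type) [Field K] [NumberField K], gross_zagier N W K)
    (h12 : thm12_fullBSD_twist) (h44 : thm44_ord_two_LAlg) (hS31 : bsdTriple_of_rank_le_one_of_conductor_lt) (hnew : exists_isNewformOf)
    (hK : IsImaginaryQuadratic K) {q p : ℕ} (hq : q.Prime) (h3 : 3 < q) (hq4 : q % 4 = 3) (hq7 : jacobiSym q 7 = -1)
    [Fact p.Prime] (hp4 : p % 4 = 1) (hp7 : legendreSym p (-7) = 1) (hβ : ∃ x : ZMod p, x ^ 4 = -7)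
    (hNo4 : LiLiuTian2024.NoIdealClassOfOrderFour (-((q : ℤ) * p))) (hdK : NumberField.discr K = -(8 * (q : ℤ) * p))
    (D₀ : ModularParametrizationData cm7 49) (hc : |D₀.c| = 1) (hw : cm7.rootNumber = 1)
    (h0 : ∃ h, D₀.cuspZeroPoint = Affine.Point.some 2 (-1) h)
    {β : ℤ} (d : KolyvaginHeegnerData D₀ β ι 1) {rq rp : ringClassField K ι 1}
    (hrq : (rq : ℂ) ^ 2 = -(q : ℂ)) (hrp : (rp : ℂ) ^ 2 = (p : ℂ)) :
    ∃ (τ : ringClassField K ι 1 ≃ₐ[ℚ] ringClassField K ι 1) (H₂ : HeegnerDatum 49 (NumberField.discr (ℚ⟮rq * rp⟯ : IntermediateField ℚ (ringClassField K ι 1))))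
      (P₂ : (cm7.baseChange (ℚ⟮rq * rp⟯ : IntermediateField ℚ (ringClassField K ι 1))).toAffine.Point) (t₁ : (cm7.baseChange (ringClassField K ι 1)).toAffine.Point) (M₁ m₁ : ℤ),
      (∀ x : ringClassField K ι 1, ((τ x : ringClassField K ι 1) : ℂ) = starRingEnd ℂ x) ∧ τ (rq * rp) = -(rq * rp) ∧ τ rq = -rq ∧ τ * τ = 1 ∧
      Affine.Point.map (W' := cm7) ((ringClassField K ι 1).subtype.comp (algebraMap (ℚ⟮rq * rp⟯ : IntermediateField ℚ (ringClassField K ι 1)) (ringClassField K ι 1))).toRatAlgHom P₂ =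
        heegnerPointComplex D₀ H₂ ∧
      Odd M₁ ∧ Odd m₁ ∧ IsOfFinAddOrder t₁ ∧
      M₁ • (∑ σ : ringClassField K ι 1 ≃ₐ[K] ringClassField K ι 1, (if σ (rq * rp) = rq * rp then (1 : ℤ) else -1) •
          Affine.Point.map (σ : ringClassField K ι 1 →ₐ[K] ringClassField K ι 1) d.y) =
        (2 * m₁) • Affine.Point.map (ℚ⟮rq * rp⟯).val P₂ + t₁ ∧
      ∀ σ : ringClassField K ι 1 ≃ₐ[K] ringClassField K ι 1, σ (rq * rp) = rq * rp →
        Affine.Point.map (σ : ringClassField K ι 1 →ₐ[K] ringClassField K ι 1) (Affine.Point.map (ℚ⟮rq * rp⟯).val P₂) =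
          Affine.Point.map (ℚ⟮rq * rp⟯).val P₂ := by
  haveI : (cm7.baseChange (ringClassField K ι 1)).IsElliptic := by rw [WeierstrassCurve.baseChange]; infer_instance
  haveI : cm7.IsGloballyMinimal := Summit.BirchSwinnertonDyer.Rank1Residual.X12.O11.RouteU.isGloballyMinimal_X049_eq
  have hp : p.Prime := Fact.out
  obtain ⟨hp2, hp7', hp4⟩ := prime_ne_two_ne_seven_of_mod_four_one hp4
  obtain ⟨hq2, hqp, hqodd, hpeven, hqp4⟩ := arith_negEightTwoPrimes_modFour hq4 hp4
  have hpj : jacobiSym p 7 = 1 := by rw [← legendreSym_neg_seven_eq_jacobiSym hp2]; exact hp7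
  have hrK := sq_eq_algebraMap_neg_natCast (ι := ι) hrq
  have hrpK := sq_eq_algebraMap_natCast' (ι := ι) hrp
  have hre : ((rq * rp : ringClassField K ι 1) : ℂ) ^ 2 = -((q : ℂ) * p) := by
    push_cast; rw [mul_pow, hrq, hrp]; ring
  have hreK : (rq * rp) ^ 2 = algebraMap K (ringClassField K ι 1) (-((q : K) * p)) := by
    rw [mul_pow, hrK, hrpK, ← map_mul]; congr 1; ring
  set Pe : (cm7.baseChange (ringClassField K ι 1)).toAffine.Point :=
    ∑ σ : ringClassField K ι 1 ≃ₐ[K] ringClassField K ι 1, (if σ (rq * rp) = rq * rp then (1 : ℤ) else -1) •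
      Affine.Point.map (σ : ringClassField K ι 1 →ₐ[K] ringClassField K ι 1) d.y with hPe
  ------------------------------------------------------------------ complex conjugation `τ` of `K[1]`
  obtain ⟨τ, hτ⟩ := Summit.BirchSwinnertonDyer.Rank1Residual.X11b.RingClassConj.exists_conj_algEquiv hK ι one_ne_zero
  have hτre : τ (rq * rp) = -(rq * rp) := by
    apply Subtype.ext
    show ((τ (rq * rp) : ringClassField K ι 1) : ℂ) = ((-(rq * rp) : ringClassField K ι 1) : ℂ)
    have hre' : ((rq * rp : ringClassField K ι 1) : ℂ) ^ 2 = -(((q : ℝ) * p : ℝ) : ℂ) := by rw [hre]; push_cast; ring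
    rw [hτ, conj_eq_neg_of_sq_eq_neg_of_pos (by have := hq.pos; have := hp.pos; positivity) hre']
    simp
  have hτrq : τ rq = -rq := by
    apply Subtype.ext
    show ((τ rq : ringClassField K ι 1) : ℂ) = ((-rq : ringClassField K ι 1) : ℂ)
    rw [hτ, conj_eq_neg_of_sq_eq_neg hq hrq]
    simp
  have hττ : τ * τ = 1 := by
    refine AlgEquiv.ext fun x ↦ Subtype.ext ?_
    change ((τ (τ x) : ringClassField K ι 1) : ℂ) = (x : ℂ)
    rw [hτ, hτ, starRingEnd_self_apply]
  ------------------------------------------------------------------ `Y_e`, the half-trace relation `M₁•P_e = (2m₁)•Y_e + t₁`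
  obtain ⟨H₂, P₂, hP₂, hfix, hanti⟩ := exists_partnerPoint_negTwoPrimes ι hw hq hp hq4 hp4 hqp hq7 hpj conductorNorm_cm7 D₀ h0 hre
  set Ye : (cm7.baseChange (ringClassField K ι 1)).toAffine.Point := Affine.Point.map (ℚ⟮rq * rp⟯).val P₂ with hYedef
  have hYefix : ∀ σ : ringClassField K ι 1 ≃ₐ[K] ringClassField K ι 1, σ (rq * rp) = rq * rp →
      Affine.Point.map (σ : ringClassField K ι 1 →ₐ[K] ringClassField K ι 1) Ye = Ye := fun σ hσ ↦ by
    rw [← map_restrictScalars_eq (K := K) σ]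
    exact hfix ((σ : ringClassField K ι 1 →ₐ[K] ringClassField K ι 1).restrictScalars ℚ) hσ
  have hYeneg : ∀ σ : ringClassField K ι 1 ≃ₐ[K] ringClassField K ι 1, σ (rq * rp) = -(rq * rp) →
      Affine.Point.map (σ : ringClassField K ι 1 →ₐ[K] ringClassField K ι 1) Ye = -Ye := fun σ hσ ↦ by
    rw [← map_restrictScalars_eq (K := K) σ]
    have h := hanti ((σ : ringClassField K ι 1 →ₐ[K] ringClassField K ι 1).restrictScalars ℚ) hσ
    exact (neg_eq_of_add_eq_zero_right h).symm
  have hF := isImaginaryQuadratic_adjoin_sqrt_neg_two_primes ι hq hp hre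
  have hdF := discr_adjoin_sqrt_neg_two_primes ι hq hp hq4 hp4 hqp hre
  have hHF : SatisfiesHeegnerHypothesis 49 (ℚ⟮rq * rp⟯ : IntermediateField ℚ (ringClassField K ι 1)) :=
    satisfiesHeegnerHypothesis_adjoin_sqrt_neg_two_primes ι hq hp hq4 hp4 hqp hq7 hpj hre conductorNorm_cm7
  have hP₂heeg : IsHeegnerPoint 49 cm7 (ℚ⟮rq * rp⟯ : IntermediateField ℚ (ringClassField K ι 1)) P₂ := ⟨D₀, H₂, _, hP₂⟩
  have hP₂nt : ¬ IsOfFinAddOrder P₂ :=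
    heegnerPoint_negTwoPrimes_not_isOfFinAddOrder_modFour h14 hGZ h12 hnew hq h3 hq4 hq7 hp4 hβ hNo4 hF hdF hHF hP₂heeg
  have hYent : ¬ IsOfFinAddOrder Ye := by
    intro h
    apply hP₂nt
    obtain ⟨n, hn, hnX⟩ := (isOfFinAddOrder_iff_zsmul_eq_zero).mp h
    refine (isOfFinAddOrder_iff_zsmul_eq_zero).mpr ⟨n, hn, ?_⟩
    apply Affine.Point.map_injective (W' := cm7) (f := (ℚ⟮rq * rp⟯).val)
    rw [map_zsmul, ← hYedef, hnX, map_zero]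
  obtain ⟨ρ₁, ρ₂, hρ₁, hρ₂, hHR⟩ := exists_heightRatio_genusPoint_partnerE_negEightTwoPrimes_modFour hCST hGZ h44 h14 hS31 hnew
    conductorNorm_cm7 D₀ hc hq h3 hq4 hq7 hp4 hp7 hβ hNo4 hK hdK ι d (rq * rp) hre _ hF hdF H₂ _ P₂ hP₂ (ℚ⟮rq * rp⟯).val
  rw [sum_S_eq_sum_algEquiv d] at hHR
  have hsumeq : (∑ σ : ringClassField K ι 1 ≃ₐ[K] ringClassField K ι 1,
      (if (σ.restrictScalars ℚ) (rq * rp) = rq * rp then (1 : ℤ) else -1) •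
        pointGalHom cm7 (ringClassField K ι 1) (σ.restrictScalars ℚ) d.y) = Pe :=
    Finset.sum_congr rfl fun σ _ ↦ by rw [← map_restrictScalars_eq (K := K) σ d.y]; rfl
  rw [hsumeq] at hHR
  obtain ⟨M₁, m₁, t₁, hM₁, hm₁, ht₁, hrel₁⟩ := exists_halfTrace_relation_e_modFour h14 hK hq h3 hq4 hq7 hp4 hβ hNo4 hdK hreK d.y Ye
    hYent hYefix hYeneg hρ₁ hρ₂ hHR
  exact ⟨τ, H₂, P₂, t₁, M₁, m₁, hτ, hτre, hτrq, hττ, hP₂, hM₁, hm₁, ht₁, hrel₁, hYefix⟩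

/-! ## §2 The χ_e package over `K[1]` with the `σ̃_p`-signature -/

set_option maxHeartbeats 500000 in -- one long assembly (§1's data + X3b-2b-F pulled back to `K[1]` + the genus transport X3b-1)
/-- **The type-β `χ_e` package in `X₀(49)(K[1])` with its `σ̃_p`-signature.** Setting and binders of A2a″'s `exists_chiE_package` plus
(F-η), (F-D), (F-norm); `B` with the genus properties `hBfix`, `hBodd`, `hBS` and the range property `hBL` (every point of `B` comes from
`X₀(49)(K[1])`). CONCLUSION: ODD `M_e`, points `R_e, t_e ∈ X₀(49)(K[1])` (`e_L R_e, e_L t_e ∈ B`, `t_e` torsion) with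
`M_e • P_e = 4 • R_e + t_e`, and for every `σ̃ ∈ Gal(K[1]/K)` with `σ̃r_q = r_q`, `σ̃r_p = −r_p` an ODD `k` with `k • (σ̃R_e + R_e) = T`.
[cite: Gross1984, §§4–5] [cite: GrossLMS1991, Prop. 5.3] [cite: CoatesLiTianZhai2015, Thm. 1.3, 1.4, 4.4 and (2.8)] [cite: Cox2013, §6.A Thm. 6.1] -/
theorem exists_chiE_package_L_modFour (hEta₀ : x049_x_sub_two_eq_etaQuotient) (hD : deuring_etaQuotient49_heegner_generates_conjPrime)
    (hEta : x049_heegner_norm_x_sub_two_not_mem) (h14 : thm14_rankOne_twist) (hCST : thm11_ringClassChar)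
    (hGZ : ∀ (N : ℕ) [NeZero N] (W : WeierstrassCurve ℚ) (K : Type) [Field K] [NumberField K], gross_zagier N W K)
    (h12 : thm12_fullBSD_twist) (h44 : thm44_ord_two_LAlg) (h13 : thm13_ord_two_LAlg)
    (hS31 : bsdTriple_of_rank_le_one_of_conductor_lt) (hnew : exists_isNewformOf)
    (hGZK : rank_eq_analyticRank_of_analyticRank_le_one)
    (hK : IsImaginaryQuadratic K) {q p : ℕ} (hq : q.Prime) (h3 : 3 < q) (hq4 : q % 4 = 3) (hq7 : jacobiSym q 7 = -1)
    [Fact p.Prime] (hp4 : p % 4 = 1) (hp7 : legendreSym p (-7) = 1) (hβ : ∃ x : ZMod p, x ^ 4 = -7)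
    (hNo4 : LiLiuTian2024.NoIdealClassOfOrderFour (-((q : ℤ) * p)))
    (h4e : ∀ Δ : OrderCl.NegDiscr, Δ.D = -((q : ℤ) * p) → ¬ 4 ∣ Nat.card (ClassGroup (OrderCl.QO Δ)))
    (hdK : NumberField.discr K = -(8 * (q : ℤ) * p))
    (D₀ : ModularParametrizationData cm7 49) (hc : |D₀.c| = 1) (hw : cm7.rootNumber = 1)
    (h0 : ∃ h, D₀.cuspZeroPoint = Affine.Point.some 2 (-1) h)
    {β : ℤ} (d : KolyvaginHeegnerData D₀ β ι 1) {rq rp : ringClassField K ι 1}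
    (hrq : (rq : ℂ) ^ 2 = -(q : ℂ)) (hrp : (rp : ℂ) ^ 2 = (p : ℂ))
    (B : AddSubgroup (cm7.baseChange ℂ).toAffine.Point) (S : Subfield ℂ)
    (hBfix : ∀ P : (cm7.baseChange (ringClassField K ι 1)).toAffine.Point,
      (∀ σ : ringClassField K ι 1 ≃ₐ[K] ringClassField K ι 1, σ rq = rq → σ rp = rp →
        Affine.Point.map (σ : ringClassField K ι 1 →ₐ[K] ringClassField K ι 1) P = P) →
      Affine.Point.map (W' := cm7) (ringClassField K ι 1).subtype.toRatAlgHom P ∈ B)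
    (hBodd : ∀ u ∈ B, IsOfFinAddOrder u → ∃ n : ℤ, Odd n ∧
      (n • u = 0 ∨ n • u = Affine.Point.some 2 (-1) (nonsingular_cm7_baseChange_two_neg_one ℂ)))
    (hBS : ∀ (E : Type) [Field E] [CharZero E] (e : E →+* ℂ), e.fieldRange ≤ S →
      ∀ z : (cm7.baseChange E).toAffine.Point, Affine.Point.map (W' := cm7) e.toRatAlgHom z ∈ B)
    (hSq : (rq : ℂ) ∈ S) (hSp : (rp : ℂ) ∈ S)
    (hBL : ∀ z ∈ B, ∃ P : (cm7.baseChange (ringClassField K ι 1)).toAffine.Point,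
      Affine.Point.map (W' := cm7) (ringClassField K ι 1).subtype.toRatAlgHom P = z) :
    ∃ (Me : ℤ) (Re te : (cm7.baseChange (ringClassField K ι 1)).toAffine.Point), Odd Me ∧ IsOfFinAddOrder te ∧
      Affine.Point.map (W' := cm7) (ringClassField K ι 1).subtype.toRatAlgHom Re ∈ B ∧
      Affine.Point.map (W' := cm7) (ringClassField K ι 1).subtype.toRatAlgHom te ∈ B ∧
      Me • (∑ σ : ringClassField K ι 1 ≃ₐ[K] ringClassField K ι 1,
          ((if σ rq = rq then (1 : ℤ) else -1) * (if σ rp = rp then (1 : ℤ) else -1)) •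
            Affine.Point.map (σ : ringClassField K ι 1 →ₐ[K] ringClassField K ι 1) d.y) = (4 : ℤ) • Re + te ∧
      ∀ σ : ringClassField K ι 1 ≃ₐ[K] ringClassField K ι 1, σ rq = rq → σ rp = -rp →
        ∃ k : ℤ, Odd k ∧ k • (Affine.Point.map (σ : ringClassField K ι 1 →ₐ[K] ringClassField K ι 1) Re + Re) =
          Affine.Point.some 2 (-1) (nonsingular_cm7_baseChange_two_neg_one (ringClassField K ι 1)) := by
  haveI : (cm7.baseChange (ringClassField K ι 1)).IsElliptic := by rw [WeierstrassCurve.baseChange]; infer_instance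
  have hp : p.Prime := Fact.out
  obtain ⟨hp2, hp7', hp4⟩ := prime_ne_two_ne_seven_of_mod_four_one hp4
  obtain ⟨hq2, hqp, hqodd, hpeven, hqp4⟩ := arith_negEightTwoPrimes_modFour hq4 hp4
  have hrK := sq_eq_algebraMap_neg_natCast (ι := ι) hrq
  have hrpK := sq_eq_algebraMap_natCast' (ι := ι) hrp
  have hq0 : (q : ringClassField K ι 1) ≠ 0 := by exact_mod_cast hq.ne_zero
  have hpL : (p : ringClassField K ι 1) ≠ 0 := by exact_mod_cast hp.ne_zero
  have hrq0 : rq ≠ 0 := by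
    intro h; rw [h, zero_pow two_ne_zero, map_neg, map_natCast] at hrK
    exact hq0 (neg_eq_zero.mp hrK.symm)
  have hrp0 : rp ≠ 0 := by
    intro h; rw [h, zero_pow two_ne_zero, map_natCast] at hrpK
    exact hpL hrpK.symm
  have hre : ((rq * rp : ringClassField K ι 1) : ℂ) ^ 2 = -((q : ℂ) * p) := by
    push_cast; rw [mul_pow, hrq, hrp]; ring
  have hreK : (rq * rp) ^ 2 = algebraMap K (ringClassField K ι 1) (-((q : K) * p)) := by
    rw [mul_pow, hrK, hrpK, ← map_mul]; congr 1; ring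
  ------------------------------------------------------------------ §1's K-side data; abbreviations `e_L`, `T`, `P_e`, `Y_e`, `ι_F`
  obtain ⟨τ, H₂, P₂, t₁, M₁, m₁, hτ, hτre, hτrq, hττ, hP₂, hM₁, hm₁, ht₁, hrel₁, hYefix⟩ :=
    exists_chiE_dataK_modFour ι h14 hCST hGZ h12 h44 hS31 hnew hK hq h3 hq4 hq7 hp4 hp7 hβ hNo4 hdK D₀ hc hw h0 d hrq hrp
  set eL := Affine.Point.map (W' := cm7) (ringClassField K ι 1).subtype.toRatAlgHom with heL
  set TL : (cm7.baseChange (ringClassField K ι 1)).toAffine.Point :=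
    Affine.Point.some 2 (-1) (nonsingular_cm7_baseChange_two_neg_one (ringClassField K ι 1)) with hTL
  set Pe : (cm7.baseChange (ringClassField K ι 1)).toAffine.Point :=
    ∑ σ : ringClassField K ι 1 ≃ₐ[K] ringClassField K ι 1, (if σ (rq * rp) = rq * rp then (1 : ℤ) else -1) •
      Affine.Point.map (σ : ringClassField K ι 1 →ₐ[K] ringClassField K ι 1) d.y with hPe
  have hPe_eq : (∑ σ : ringClassField K ι 1 ≃ₐ[K] ringClassField K ι 1,
      ((if σ rq = rq then (1 : ℤ) else -1) * (if σ rp = rp then (1 : ℤ) else -1)) •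
        Affine.Point.map (σ : ringClassField K ι 1 →ₐ[K] ringClassField K ι 1) d.y) = Pe :=
    Finset.sum_congr rfl fun σ _ ↦ by rw [chiSign_mul_eq hrK hrpK hrq0 hrp0 σ]
  rw [hPe_eq]
  have heLT : eL TL = Affine.Point.some 2 (-1) (nonsingular_cm7_baseChange_two_neg_one ℂ) := map_cm7_twoTorsion _
  set ιF : (ℚ⟮rq * rp⟯ : IntermediateField ℚ (ringClassField K ι 1)) →+* ℂ :=
    (ringClassField K ι 1).subtype.comp (algebraMap (ℚ⟮rq * rp⟯ : IntermediateField ℚ (ringClassField K ι 1)) (ringClassField K ι 1)) with hιF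
  have hP₂maps : eL (Affine.Point.map (ℚ⟮rq * rp⟯).val P₂) = Affine.Point.map (W' := cm7) ιF.toRatAlgHom P₂ := by
    rw [heL]; cases P₂ <;> rfl
  set Ye : (cm7.baseChange (ringClassField K ι 1)).toAffine.Point := Affine.Point.map (ℚ⟮rq * rp⟯).val P₂ with hYedef
  ------------------------------------------------------------------ the F-side package (X3b-2b-F) at `F = ℚ(r_q r_p)`
  have hF := isImaginaryQuadratic_adjoin_sqrt_neg_two_primes ι hq hp hre
  have hdF := discr_adjoin_sqrt_neg_two_primes ι hq hp hq4 hp4 hqp hre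
  haveI := (finiteDimensional_and_isGalois_ringClassField hF ιF one_ne_zero).1
  haveI := (finiteDimensional_and_isGalois_ringClassField hF ιF one_ne_zero).2
  haveI : NumberField (ringClassField (ℚ⟮rq * rp⟯ : IntermediateField ℚ (ringClassField K ι 1)) ιF 1) := numberField_ringClassField hF ιF one_ne_zero
  have hreS : ((rq * rp : ringClassField K ι 1) : ℂ) ∈ S := by push_cast; exact S.mul_mem hSq hSp
  have hFS : ∀ x : (ℚ⟮rq * rp⟯ : IntermediateField ℚ (ringClassField K ι 1)), ιF x ∈ S := fun x ↦
    algebraMap_adjoin_mem_of_mem (F₀ := ℚ) (ringClassField K ι 1).subtype S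
      (fun y ↦ by rw [eq_ratCast, Subfield.coe_subtype, SubfieldClass.coe_ratCast]; exact SubfieldClass.ratCast_mem S y)
      (r := rq * rp) hreS x
  have hκ : ιF ⟨rq * rp, IntermediateField.mem_adjoin_simple_self ℚ (rq * rp)⟩ = (rq : ℂ) * (rp : ℂ) := by
    rw [hιF, RingHom.comp_apply, IntermediateField.algebraMap_apply, Subfield.coe_subtype]
    rfl
  obtain ⟨κ', M', k', r', g, τ', Φ₁, Tr₁, P'₁, Y', t', hκ', hM', hτ', hr'C, hg, hΦB, hP'B, hY'B, h2Φ₁, hTr₁, hrel', ht', hθ, hΦ₁fix,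
    hY'fix, hgΦ, hgY, hτ'Φ, hτ'Y⟩ :=
    exists_partnerField_packageF_modFour ιF hEta₀ hD hEta h14 hCST hGZ h44 h13 hnew hGZK hF hq h3 hq4 hq7 hp4 hp7 hβ h4e hdF D₀ hc hw h0 H₂ P₂
      hP₂ hrq hrp _ hκ B S hBS hSq hSp hFS
  -- `ι_F` is made opaque from here on (its value would be unfolded by the unifier inside every `F[1]`-type)
  have hιFa : ∀ a : (ℚ⟮rq * rp⟯ : IntermediateField ℚ (ringClassField K ι 1)), ιF a = ((a : ringClassField K ι 1) : ℂ) := fun a ↦ rfl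
  clear_value ιF
  set eF := Affine.Point.map (W' := cm7) (ringClassField (ℚ⟮rq * rp⟯ : IntermediateField ℚ (ringClassField K ι 1)) ιF 1).subtype.toRatAlgHom with heF
  have hTF : eF (Affine.Point.some 2 (-1) (nonsingular_cm7_baseChange_two_neg_one (ringClassField (ℚ⟮rq * rp⟯ : IntermediateField ℚ (ringClassField K ι 1)) ιF 1))) = Affine.Point.some 2 (-1) (nonsingular_cm7_baseChange_two_neg_one ℂ) := map_cm7_twoTorsion _
  have hinj : Function.Injective eL := fun a b h ↦
    Affine.Point.map_injective (W' := cm7) (f := (ringClassField K ι 1).subtype.toRatAlgHom) h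
  have hF₁inj : Function.Injective eF := fun a b h ↦ Affine.Point.map_injective (W' := cm7) (f := (ringClassField (ℚ⟮rq * rp⟯ : IntermediateField ℚ (ringClassField K ι 1)) ιF 1).subtype.toRatAlgHom) h
  -- `e_F Tr = e_L Y_e`
  have hTrYe : eF Tr₁ = eL Ye := by
    have hc' : (ringClassField (ℚ⟮rq * rp⟯ : IntermediateField ℚ (ringClassField K ι 1)) ιF 1).subtype.toRatAlgHom.comp (algebraMap (ℚ⟮rq * rp⟯ : IntermediateField ℚ (ringClassField K ι 1)) (ringClassField (ℚ⟮rq * rp⟯ : IntermediateField ℚ (ringClassField K ι 1)) ιF 1)).toRatAlgHom = ιF.toRatAlgHom :=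
      AlgHom.ext fun x ↦ coe_algebraMap_ringClassField ιF 1 x
    rw [hTr₁, heF, Affine.Point.map_map, hc', ← hP₂maps]
  ------------------------------------------------------------------ `K[1]`-preimages (range property `hBL`) and pulled-back relations
  -- (equalities of `ℂ`- and `F[1]`-points are closed by `simp only`: `rw [map_zsmul]` / a closing `rfl` there is too expensive)
  obtain ⟨ΦL, hΦL⟩ := hBL _ hΦB
  obtain ⟨P'L, hP'L⟩ := hBL _ hP'B
  obtain ⟨Y'L, hY'L⟩ := hBL _ hY'B
  have h2ΦL : (2 : ℤ) • ΦL = Ye + P'L := hinj (by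
    have e := congrArg eF h2Φ₁
    simp only [map_zsmul, map_add] at e
    simp only [map_zsmul, map_add, hΦL, hP'L, ← hTrYe, e])
  obtain ⟨t'L, ht'L⟩ : ∃ X : (cm7.baseChange (ringClassField K ι 1)).toAffine.Point, X = M' • P'L - (4 : ℤ) • (k' • Y'L) := ⟨_, rfl⟩
  have ht'eq : t' = M' • P'₁ - (4 : ℤ) • (k' • Y') := eq_sub_of_add_eq' hrel'.symm
  have ht'LF : eL t'L = eF t' := by
    rw [ht'eq, ht'L]
    simp only [map_sub, map_zsmul, hP'L, hY'L]
  have ht'Lt : IsOfFinAddOrder t'L :=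
    (Function.Injective.isOfFinAddOrder_iff hinj).mp (by rw [ht'LF]; exact eF.isOfFinAddOrder ht')
  ------------------------------------------------------------------ the package: `M_e := M′M₁`, `R_e := (m₁M′)Φ − (2m₁k′)Y′`, `t_e := M′t₁ − (2m₁)t′`
  obtain ⟨Re, hRe⟩ : ∃ X : (cm7.baseChange (ringClassField K ι 1)).toAffine.Point, X = (m₁ * M') • ΦL - (2 * m₁ * k') • Y'L := ⟨_, rfl⟩
  obtain ⟨te, hte⟩ : ∃ X : (cm7.baseChange (ringClassField K ι 1)).toAffine.Point, X = M' • t₁ - (2 * m₁) • t'L := ⟨_, rfl⟩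
  have hrel : (M' * M₁) • Pe = (4 : ℤ) • Re + te := by
    rw [mul_zsmul, hrel₁, hRe, hte, ht'L]
    linear_combination (norm := module) (-(2 * m₁ * M')) • h2ΦL
  have hPeB : eL Pe ∈ B := hBfix Pe (fun σ h1 h2 ↦ (isChiPoint_twistedSum (K := K) hreK (mul_ne_zero hrq0 hrp0) d.y).1 σ
    (by rw [map_mul, h1, h2]))
  have hYeB : eL Ye ∈ B := hBfix Ye (fun σ h1 h2 ↦ hYefix σ (by rw [map_mul, h1, h2]))
  have ht₁B : eL t₁ ∈ B := by
    rw [eq_sub_of_add_eq' hrel₁.symm, map_sub, map_zsmul, map_zsmul]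
    exact B.sub_mem (B.zsmul_mem hPeB _) (B.zsmul_mem hYeB _)
  have hReB : eL Re ∈ B := by
    rw [hRe, map_sub, map_zsmul, map_zsmul, hΦL, hY'L]
    exact B.sub_mem (B.zsmul_mem hΦB _) (B.zsmul_mem hY'B _)
  have ht'B : eF t' ∈ B := by
    rw [ht'eq]
    simp only [map_sub, map_zsmul]
    exact B.sub_mem (B.zsmul_mem hP'B _) (B.zsmul_mem (B.zsmul_mem hY'B _) _)
  have hteB : eL te ∈ B := by
    rw [hte, map_sub, map_zsmul, map_zsmul, ht'LF]
    exact B.sub_mem (B.zsmul_mem ht₁B _) (B.zsmul_mem ht'B _)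
  have hte_t : IsOfFinAddOrder te := by
    obtain ⟨a, ha, ha0⟩ := (isOfFinAddOrder_iff_zsmul_eq_zero).mp ht₁
    obtain ⟨b, hb, hb0⟩ := (isOfFinAddOrder_iff_zsmul_eq_zero).mp ht'Lt
    refine (isOfFinAddOrder_iff_zsmul_eq_zero).mpr ⟨a * b, mul_ne_zero ha hb, ?_⟩
    rw [hte, zsmul_sub, smul_smul, smul_smul, show a * b * M' = (b * M') * a by ring, show a * b * (2 * m₁) = (a * (2 * m₁)) * b by ring,
      mul_zsmul, ha0, zsmul_zero, mul_zsmul, hb0, zsmul_zero, sub_zero]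
  ------------------------------------------------------------------ `θ = 0`: the odd killer of `t′` (genus property `hBodd`) kills it to `O`
  obtain ⟨n, hn, hnt⟩ := hBodd (eL t'L) (by rw [ht'LF]; exact ht'B) (eL.isOfFinAddOrder ht'Lt)
  have hnt0 : n • t'L = 0 := by
    rcases hnt with h | h
    · exact hinj (by simp only [map_zsmul, h, map_zero])
    · exact absurd (hF₁inj (by simp only [map_zsmul, ← ht'LF, h, hTF])) (hθ n hn)
  ------------------------------------------------------------------ the signature under `σ̃` (`σ̃ r_q = r_q`, `σ̃ r_p = −r_p`)
  refine ⟨M' * M₁, Re, te, hM'.mul hM₁, hte_t, hReB, hteB, hrel, fun σ hσq hσp ↦ ⟨n, hn, ?_⟩⟩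
  -- the auxiliary `ψ = σ̃τ`: fixes `F`, negates `r_q` and `r_p`
  obtain ⟨ψ, hψ⟩ : ∃ ψ : ringClassField K ι 1 ≃ₐ[ℚ] ringClassField K ι 1, ψ = (σ.restrictScalars ℚ) * τ := ⟨_, rfl⟩
  have hτx : ∀ x : ringClassField K ι 1, τ (τ x) = x := fun x ↦ by rw [← AlgEquiv.mul_apply, hττ, AlgEquiv.one_apply]
  have hψσ : ∀ X : (cm7.baseChange (ringClassField K ι 1)).toAffine.Point,
      Affine.Point.map (σ : ringClassField K ι 1 →ₐ[K] ringClassField K ι 1) X =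
        Affine.Point.map (ψ : ringClassField K ι 1 →ₐ[ℚ] ringClassField K ι 1)
          (Affine.Point.map (τ : ringClassField K ι 1 →ₐ[ℚ] ringClassField K ι 1) X) := fun X ↦ by
    have e' : (σ : ringClassField K ι 1 →ₐ[K] ringClassField K ι 1).restrictScalars ℚ =
        (ψ : ringClassField K ι 1 →ₐ[ℚ] ringClassField K ι 1).comp (τ : ringClassField K ι 1 →ₐ[ℚ] ringClassField K ι 1) :=
      AlgHom.ext fun x ↦ by
        change σ x = ψ (τ x)
        rw [hψ, AlgEquiv.mul_apply, AlgEquiv.restrictScalars_apply, hτx]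
    rw [← map_restrictScalars_eq (K := K) σ, e', Affine.Point.map_map]
  have hψrq : ψ rq = -rq := by
    rw [hψ, AlgEquiv.mul_apply, hτrq, map_neg, AlgEquiv.restrictScalars_apply, hσq]
  have hψre : ψ (rq * rp) = rq * rp := by
    rw [hψ, AlgEquiv.mul_apply, hτre, map_neg, AlgEquiv.restrictScalars_apply, map_mul, hσq, hσp]; ring
  have hψrp : ψ rp = -rp := by
    have h := hψre
    rw [map_mul, hψrq] at h
    have : rq * (ψ rp + rp) = 0 := by rw [mul_add]; linear_combination -h
    rcases mul_eq_zero.mp this with h0 | h0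
    · exact absurd h0 hrq0
    · exact eq_neg_of_add_eq_zero_left h0
  have hψF : ∀ a : (ℚ⟮rq * rp⟯ : IntermediateField ℚ (ringClassField K ι 1)), ψ (algebraMap _ (ringClassField K ι 1) a) = algebraMap _ (ringClassField K ι 1) a := fun a ↦ by
    rw [IntermediateField.algebraMap_apply]
    exact apply_eq_self_of_mem_adjoin_simple ψ hψre a.2
  ------------------------------------------------------------------ genus transport (X3b-1): `ψ` acts on `Φ`, `Y′` as `g̃`; `τ` as `τ′`
  have hcoe : ∀ a : (ℚ⟮rq * rp⟯ : IntermediateField ℚ (ringClassField K ι 1)), ((algebraMap _ (ringClassField (ℚ⟮rq * rp⟯ : IntermediateField ℚ (ringClassField K ι 1)) ιF 1) a : (ringClassField (ℚ⟮rq * rp⟯ : IntermediateField ℚ (ringClassField K ι 1)) ιF 1)) : ℂ) = ((algebraMap _ (ringClassField K ι 1) a : ringClassField K ι 1) : ℂ) :=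
    fun a ↦ by rw [coe_algebraMap_ringClassField, IntermediateField.algebraMap_apply]; exact hιFa a
  have hr : (rp : ℂ) = (r' : ℂ) := hr'C.symm
  have hψg : ((ψ rp : ringClassField K ι 1) : ℂ) = ((g r' : (ringClassField (ℚ⟮rq * rp⟯ : IntermediateField ℚ (ringClassField K ι 1)) ιF 1)) : ℂ) := by
    rw [hψrp, hg]; push_cast; rw [hr]
  have hTΦ : eL (Affine.Point.map (ψ : ringClassField K ι 1 →ₐ[ℚ] ringClassField K ι 1) ΦL) =
      eF (Affine.Point.map (g : (ringClassField (ℚ⟮rq * rp⟯ : IntermediateField ℚ (ringClassField K ι 1)) ιF 1) →ₐ[ℚ⟮rq * rp⟯] (ringClassField (ℚ⟮rq * rp⟯ : IntermediateField ℚ (ringClassField K ι 1)) ιF 1)) Φ₁) :=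
    map_subtype_map_eq_of_genusTransport ι _ (ringClassField (ℚ⟮rq * rp⟯ : IntermediateField ℚ (ringClassField K ι 1)) ιF 1) hcoe r' rp hr ψ hψF g hψg Φ₁ hΦ₁fix ΦL hΦL
  have hTY : eL (Affine.Point.map (ψ : ringClassField K ι 1 →ₐ[ℚ] ringClassField K ι 1) Y'L) =
      eF (Affine.Point.map (g : (ringClassField (ℚ⟮rq * rp⟯ : IntermediateField ℚ (ringClassField K ι 1)) ιF 1) →ₐ[ℚ⟮rq * rp⟯] (ringClassField (ℚ⟮rq * rp⟯ : IntermediateField ℚ (ringClassField K ι 1)) ιF 1)) Y') :=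
    map_subtype_map_eq_of_genusTransport ι _ (ringClassField (ℚ⟮rq * rp⟯ : IntermediateField ℚ (ringClassField K ι 1)) ιF 1) hcoe r' rp hr ψ hψF g hψg Y' hY'fix Y'L hY'L
  have hcL : ∀ X, eL (Affine.Point.map (τ : ringClassField K ι 1 →ₐ[ℚ] ringClassField K ι 1) X) =
      Affine.Point.map (W' := cm7) conjRatAlgHom (eL X) := map_subtype_map_conj_cm7 τ hτ
  have hcF : ∀ X, eF (Affine.Point.map (τ' : (ringClassField (ℚ⟮rq * rp⟯ : IntermediateField ℚ (ringClassField K ι 1)) ιF 1) →ₐ[ℚ] (ringClassField (ℚ⟮rq * rp⟯ : IntermediateField ℚ (ringClassField K ι 1)) ιF 1)) X) = Affine.Point.map (W' := cm7) conjRatAlgHom (eF X) :=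
    map_subtype_map_conj_cm7 τ' hτ'
  have hψΦ : Affine.Point.map (ψ : ringClassField K ι 1 →ₐ[ℚ] ringClassField K ι 1) ΦL = Ye - ΦL := hinj (by
    rw [hTΦ, hgΦ]; simp only [map_sub, hTrYe, hΦL])
  have hψY : Affine.Point.map (ψ : ringClassField K ι 1 →ₐ[ℚ] ringClassField K ι 1) Y'L = TL - Y'L := hinj (by
    rw [hTY, hgY]; simp only [map_sub, hTF, hY'L, heLT])
  have hτΦ : Affine.Point.map (τ : ringClassField K ι 1 →ₐ[ℚ] ringClassField K ι 1) ΦL = (κ' : ℤ) • TL - ΦL := hinj (by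
    rw [hcL, hΦL, ← hcF, hτ'Φ]; simp only [map_sub, map_zsmul, hTF, hΦL, heLT])
  have hτY : Affine.Point.map (τ : ringClassField K ι 1 →ₐ[ℚ] ringClassField K ι 1) Y'L = TL - Y'L := hinj (by
    rw [hcL, hY'L, ← hcF, hτ'Y]; simp only [map_sub, hTF, hY'L, heLT])
  have hψT : Affine.Point.map (ψ : ringClassField K ι 1 →ₐ[ℚ] ringClassField K ι 1) TL = TL := by
    rw [hTL, Affine.Point.map_some]; congr 1
    · exact map_ofNat _ 2
    · simp only [map_neg, map_one]
  ------------------------------------------------------------------ the signature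
  have hT2 : 2 • TL = 0 := by rw [two_nsmul]; exact cm7_twoTorsion_add_self _
  have e1 : Affine.Point.map (τ : ringClassField K ι 1 →ₐ[ℚ] ringClassField K ι 1) Re =
      (m₁ * M') • ((κ' : ℤ) • TL - ΦL) - (2 * m₁ * k') • (TL - Y'L) := by rw [hRe, map_sub, map_zsmul, map_zsmul, hτΦ, hτY]
  have e2 : Affine.Point.map (σ : ringClassField K ι 1 →ₐ[K] ringClassField K ι 1) Re =
      (m₁ * M') • ((κ' : ℤ) • TL - (Ye - ΦL)) - (2 * m₁ * k') • (TL - (TL - Y'L)) := by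
    rw [hψσ, e1, map_sub, map_zsmul, map_zsmul, map_sub, map_sub, map_zsmul, hψT, hψΦ, hψY]
  have hfinal : Affine.Point.map (σ : ringClassField K ι 1 →ₐ[K] ringClassField K ι 1) Re + Re =
      (m₁ * M' * (κ' : ℤ)) • TL + m₁ • t'L := by
    rw [e2, hRe, ht'L]
    linear_combination (norm := module) (m₁ * M') • h2ΦL
  rw [hfinal, zsmul_add, smul_smul, smul_comm n m₁ t'L, hnt0, zsmul_zero, add_zero]
  exact zsmul_twoTorsion_of_odd hT2 (hn.mul ((hm₁.mul hM').mul ((Int.odd_coe_nat κ').mpr hκ')))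

end ChiE

end Summit.BirchSwinnertonDyer.BirchSwinnertonDyer.Theorems.GoldfeldGoodTwists

end
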